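import Literature.MathematicalPhysics.QuantumLattice.DWaveSourceNNNHoppingEnergyDensity
import Literature.MathematicalPhysics.QuantumLattice.DWaveSourceEnergyDensityExists
import Literature.MathematicalPhysics.QuantumLattice.DWaveSourceNNNHoppingWindowHamiltonian
import Literature.MathematicalPhysics.QuantumLattice.DWaveSourceNNNHoppingEnergyDensityLimit
import HarnessLib

/-!
# The thermodynamic-limit ground-state energy density `e_src(t', U, μ, h)` of the `d`-wave pair-sourced
# `t–t'` Hubbard torus EXISTS; variational characterisation, certified windows, transport in `h`, and the
# Griffiths / cusp dictionary of `dWaveOrderParameterTT'` made unconditional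

Topic `Literature/MathematicalPhysics/QuantumLattice` (family `hubbard`); the `t' ≠ 0` TWIN of
`DWaveSourceEnergyDensityExists.lean` + `DWaveSourceEnergyDensityTransport.lean`, on the objects of
`DWaveSourceNNNHoppingEnergyDensity.lean` (`dWaveSourceEnergyObsTT'`, `dWaveSourceEnergyDensityTT'`),
`DWaveSourceNNNHopping.lean` (`dWaveSourceTorusTT' L t' U μ h = hubbardTorusTT' L 1 t' U − μN − h(Δ_d + Δ_d†)`),
`PinningFieldPairingOrder.lean` / `DWaveSourceNNNHoppingOrderParameter.lean` (`dWaveSourceDensityTT'`,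
`dWaveOrderParameterTT'`, `HasDWaveOrderTT'`, the Hellmann–Feynman sandwich) and p5's CONDITIONAL
dictionary `DWaveSourceNNNHoppingEnergyDensityLimit.lean` (hypothesis `hg : E_{L+1}(h)/(L+1)² → g(h)`).
Written for the cuprate cell (`hubbard-cq`): CQ anchor `(U, n, t') = (8, 7/8, −1/4)`.

* §1 hermiticity of `E^src_{t'}` and the PERIODISATION IDENTITY `Σ_v T_v Γ(E^src_{t'}) T_v⁻¹ = A_L(t',U,μ,h)`
  (`L ≥ 3`; the tree's `sum_conj_fockTranslate_pairSourceObjectiveTT'_dWave` in `relabel` form).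
* §2 `tendsto_dWaveSourceEnergyDensityTT'` — THE LIMIT EXISTS for all real `t', U, μ, h` (model-free
  `exists_tendsto_groundEnergy_div_pow`).
* §3 variational characterisation over translation-invariant states (≤, attained, torus-limit ground
  states carry `e_src`); §4 certified finite-volume windows pass to the limit.
* §5–§7 (`t'` twins of the transport file): finite-volume monotonicity; `e_src(t',U,μ,·)` concave on `ℝ`,
  non-increasing on `h ≥ 0`, below its value at `h = 0`, `2B_d`-Lipschitz; Griffiths' lemma, the cusp
  identity `dWaveOrderParameterTT' t' U μ = ⨅_{h>0}(e_src(0) − e_src(h))/(2h) = lim_{h↓0}`, `HasDWaveOrderTT'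
  ↔` linear cusp, ONE-CHORD CEILING `dWaveOrderParameterTT' ≤ (hi₀ − lo_h)/(2h)`; window transport rules.

Everything is PROVED; no definition, no named fact. HONEST SCOPE: hopping `t = 1`, any real `t'`;
ceilings on `dWaveOrderParameterTT'` only, never a floor; nothing here bears on `d`-wave order.

## References
* T. Koma, H. Tasaki, J. Stat. Phys. 76 (1994) 745, §1. [cite: KomaTasaki1994, §1]
* O. Bratteli, A. Kishimoto, D. W. Robinson, CMP 64 (1978) 41, Thm. 2. [cite: BratteliKishimotoRobinson1978, Thm. 2]
* R. B. Griffiths, Phys. Rev. 152 (1966) 240, §II. [cite: Griffiths1966, §II]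
* R. B. Griffiths, J. Math. Phys. 5 (1964) 1215, §II. [cite: Griffiths1964, §II]
* R. B. Israel, *Convexity in the Theory of Lattice Gases* (1979), Thm. I.3.4. [cite: Israel1979, Thm. I.3.4]
* D. Ruelle, *Statistical Mechanics* (1969), §3.3. [cite: Ruelle1969, §3.3]
* H. Xu et al., Science 384 (2024) eadh7691, eq. (1). [cite: XuEtAl2024, eq. (1) p. 2]
-/

noncomputable section

namespace Literature.MathematicalPhysics.QuantumLattice

open _root_.Matrix Finset HubbardWave0 Literature.Probability.LatticeModels _root_.Filter
open scoped _root_.Topology ComplexOrder BigOperators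

/-! ### §1 The sourced `t–t'` energy-density observable -/

/-- **`E^src_{t'}` is Hermitian** (real `t', U, μ, h`). [cite: KomaTasaki1994, §1] -/
theorem dWaveSourceEnergyObsTT'_isHermitian (t' U μ h : ℝ) : (dWaveSourceEnergyObsTT' t' U μ h).IsHermitian := by
  unfold dWaveSourceEnergyObsTT'
  have h1 : (fermionEmbed (PolySite.incl thicken_subset_dWaveSourceWindow)
      ((hubbardTTPrimeFermionInteraction 1 t' U).meanEnergyObs 1)).IsHermitian := by
    rw [Matrix.IsHermitian, ← fermionEmbed_conjTranspose,
      (FermionInteraction.meanEnergyObs_isHermitian (hubbardTTPrimeFermionInteraction_isHermitian 1 t' U) 1).eq]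
  have h2 : ((μ : ℂ) • ∑ σ : Fin 2, nAt 0 zero_mem_dWaveSourceWindow σ :
      FermionOp dWaveSourceWindow).IsHermitian := by
    refine IsHermitian.smul ?_ (by rw [isSelfAdjoint_iff, Complex.star_def, Complex.conj_ofReal])
    rw [Matrix.IsHermitian, Matrix.conjTranspose_sum]
    refine Finset.sum_congr rfl fun σ _ => ?_
    rw [nAt, ← numberAt_orb, (numberAt_isHermitian _).eq]
  have h3 : ((h : ℂ) • (fermionEmbed (PolySite.incl pairRegion_subset_dWaveSourceWindow)
        (localPairAt (insert (0 : Site 2) unitSteps) dWaveFormFactor 0) +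
      (fermionEmbed (PolySite.incl pairRegion_subset_dWaveSourceWindow)
        (localPairAt (insert (0 : Site 2) unitSteps) dWaveFormFactor 0))ᴴ) :
      FermionOp dWaveSourceWindow).IsHermitian := by
    refine IsHermitian.smul ?_ (by rw [isSelfAdjoint_iff, Complex.star_def, Complex.conj_ofReal])
    exact Matrix.isHermitian_add_transpose_self _
  exact (h1.sub h2).sub h3

/-- **Periodisation identity** (`L ≥ 3`): the torus translates of `Γ(E^src)` sum to the sourced torus
Hamiltonian, `Σ_{v ∈ (ℤ/Lℤ)²} T_v Γ(E^src) T_v⁻¹ = A_L(U,μ,h)` — the tree's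
`sum_conj_fockTranslate_pairSourceObjective` (`T_v X T_v⁻¹ = U_v X U_vᴴ`). [cite: BratteliRobinsonII1997, §6.2.4] -/
theorem sum_relabel_translate_dWaveSourceEnergyObsTT' {L : ℕ} [NeZero L] (hL : 3 ≤ L)
    (hInj : Set.InjOn (Torus.proj (d := 2) L) ↑dWaveSourceWindow) (t' U μ h : ℝ) :
    ∑ v : TorusSite 2 L, relabel (Orb.translate v)
        (fermionEmbed (PolySite.toTorusEmb L hInj) (dWaveSourceEnergyObsTT' t' U μ h)) =
      dWaveSourceTorusTT' L t' U μ h := by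
  have key := sum_conj_fockTranslate_pairSourceObjectiveTT'_dWave L thicken_subset_dWaveSourceWindow
    zero_mem_dWaveSourceWindow pairRegion_subset_dWaveSourceWindow hInj hL t' U μ h
  rw [← key]
  refine Finset.sum_congr rfl fun v _ => ?_
  rw [relabel_eq_fockRelabel_conj]
  rfl

/-- The periodisation identity along the sides `L + 1 ≥ 3`, in the hypothesis shape of
`exists_tendsto_groundEnergy_div_pow`. [cite: BratteliRobinsonII1997, §6.2.4] -/
theorem sum_relabel_translate_dWaveSourceEnergyObsTT'_succ (t' U μ h : ℝ) :
    ∀ L : ℕ, 2 ≤ L → ∀ hInj : Set.InjOn (Torus.proj (d := 2) (L + 1)) ↑dWaveSourceWindow,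
      ∑ v : TorusSite 2 (L + 1), relabel (Orb.translate v)
          (fermionEmbed (PolySite.toTorusEmb (L + 1) hInj) (dWaveSourceEnergyObsTT' t' U μ h)) =
        dWaveSourceTorusTT' (L + 1) t' U μ h :=
  fun _ hL hInj => sum_relabel_translate_dWaveSourceEnergyObsTT' (by omega) hInj t' U μ h

/-! ### §2 The thermodynamic limit exists -/

/-- The model-free limit theorem instantiated: limit, minimality over translation-invariant states,
attainment. [cite: BratteliKishimotoRobinson1978, Thm. 2] -/
theorem exists_tendsto_groundEnergy_dWaveSourceTorusTT'_div_sq (t' U μ h : ℝ) :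
    ∃ e : ℝ, Tendsto (fun L : ℕ => (dWaveSourceTorusTT' (L + 1) t' U μ h).groundEnergy / (((L + 1 : ℕ) : ℝ)) ^ 2)
        atTop (𝓝 e) ∧
      (∀ ω : InfVolFermionState 2, ω.IsTranslationInvariant →
        e ≤ (ω.expect dWaveSourceWindow (dWaveSourceEnergyObsTT' t' U μ h)).re) ∧
      ∃ ω : InfVolFermionState 2, ω.IsTranslationInvariant ∧
        (ω.expect dWaveSourceWindow (dWaveSourceEnergyObsTT' t' U μ h)).re = e :=
  exists_tendsto_groundEnergy_div_pow (d := 2) (dWaveSourceEnergyObsTT'_isHermitian t' U μ h)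
    (H := fun L => dWaveSourceTorusTT' (L + 1) t' U μ h) (sum_relabel_translate_dWaveSourceEnergyObsTT'_succ t' U μ h)

/-- **THE LIMIT EXISTS**: `E₀(A_{L+1}(U,μ,h))/(L+1)² → e_src(U,μ,h)` for all real `U, μ, h` — discharging
the convergence hypothesis of the sourced Hellmann–Feynman bracket in thermodynamic-limit form
(`Summit.Ventures.CertifiedManyBodySolver.Observables.SourcedOrderParameterFloor` §3).
[cite: Ruelle1969, §3.3] -/
theorem tendsto_dWaveSourceEnergyDensityTT' (t' U μ h : ℝ) :
    Tendsto (fun L : ℕ => (dWaveSourceTorusTT' (L + 1) t' U μ h).groundEnergy / (((L + 1 : ℕ) : ℝ)) ^ 2)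
      atTop (𝓝 (dWaveSourceEnergyDensityTT' t' U μ h)) := by
  obtain ⟨e, he, -, -⟩ := exists_tendsto_groundEnergy_dWaveSourceTorusTT'_div_sq t' U μ h
  exact tendsto_nhds_limUnder ⟨e, he⟩

/-! ### §3 Variational characterisation -/

/-- **Variational principle (every translation-invariant state is above `e_src`)**:
`e_src(U,μ,h) ≤ Re ω(E^src(U,μ,h))` for every translation-invariant infinite-volume state `ω` of the
lattice fermions on `ℤ²`. [cite: BratteliKishimotoRobinson1978, Thm. 2] -/
theorem dWaveSourceEnergyDensityTT'_le_re_expect (t' U μ h : ℝ) (ω : InfVolFermionState 2)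
    (hω : ω.IsTranslationInvariant) :
    dWaveSourceEnergyDensityTT' t' U μ h ≤ (ω.expect dWaveSourceWindow (dWaveSourceEnergyObsTT' t' U μ h)).re := by
  obtain ⟨e, he, hle, -⟩ := exists_tendsto_groundEnergy_dWaveSourceTorusTT'_div_sq t' U μ h
  rw [tendsto_nhds_unique (tendsto_dWaveSourceEnergyDensityTT' t' U μ h) he]
  exact hle ω hω

/-- **The minimum is attained**: some translation-invariant state has `Re ω(E^src) = e_src`
(a torus limit of ground-state vectors). [cite: BratteliKishimotoRobinson1978, Thm. 2] -/
theorem exists_re_expect_eq_dWaveSourceEnergyDensityTT' (t' U μ h : ℝ) :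
    ∃ ω : InfVolFermionState 2, ω.IsTranslationInvariant ∧
      (ω.expect dWaveSourceWindow (dWaveSourceEnergyObsTT' t' U μ h)).re = dWaveSourceEnergyDensityTT' t' U μ h := by
  obtain ⟨e, he, -, ω, hω, hωe⟩ := exists_tendsto_groundEnergy_dWaveSourceTorusTT'_div_sq t' U μ h
  exact ⟨ω, hω, hωe.trans (tendsto_nhds_unique he (tendsto_dWaveSourceEnergyDensityTT' t' U μ h))⟩

/-- **Torus limits of sourced ground states carry `e_src`.** If `ψ L` is, for every side `L ≥ 1`, a unit
ground-state vector of `A_L(U,μ,h)` and `ω` is a torus limit of `ψ` along `Ls → ∞`, then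
`Re ω(E^src(U,μ,h)) = e_src(U,μ,h)`. [cite: BratteliRobinsonII1997, §6.2.4] -/
theorem InfVolFermionState.IsTorusLimitOf.re_expect_dWaveSourceEnergyObsTT'_eq (t' U μ h : ℝ)
    {ψ : ∀ L, Fock (Orb (FermionTorus 2 L))}
    (h1 : ∀ (L : ℕ) [NeZero L], star (ψ L) ⬝ᵥ ψ L = 1)
    (hψ : ∀ (L : ℕ) [NeZero L],
      dWaveSourceTorusTT' L t' U μ h *ᵥ ψ L = (((dWaveSourceTorusTT' L t' U μ h).groundEnergy : ℝ) : ℂ) • ψ L)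
    {Ls : ℕ → ℕ} (hLs : Tendsto Ls atTop atTop) {ω : InfVolFermionState 2} (hω : ω.IsTorusLimitOf ψ Ls) :
    (ω.expect dWaveSourceWindow (dWaveSourceEnergyObsTT' t' U μ h)).re = dWaveSourceEnergyDensityTT' t' U μ h := by
  set F : ℕ → ℝ := fun n =>
    (torusAvgExpect n dWaveSourceWindow (dWaveSourceEnergyObsTT' t' U μ h) (ψ n)).re with hF
  set G : ℕ → ℝ := fun K =>
    (dWaveSourceTorusTT' (K + 1) t' U μ h).groundEnergy / (((K + 1 : ℕ) : ℝ)) ^ 2 with hG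
  -- the averaged expectations of `E^src` are the energies per site (for all large sides)
  have hev : ∀ᶠ K : ℕ in atTop, F (K + 1) = G K :=
    re_torusAvgExpect_eq_groundEnergy_div_of_groundState (d := 2) (L₀ := 2)
      (H := fun L => dWaveSourceTorusTT' (L + 1) t' U μ h) (sum_relabel_translate_dWaveSourceEnergyObsTT'_succ t' U μ h)
      (ψ := ψ) (fun K _ => h1 (K + 1)) (fun K _ => hψ (K + 1))
  have hlim : Tendsto (fun j => F (Ls j)) atTop
      (𝓝 (ω.expect dWaveSourceWindow (dWaveSourceEnergyObsTT' t' U μ h)).re) :=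
    (Complex.continuous_re.tendsto _).comp (hω dWaveSourceWindow (dWaveSourceEnergyObsTT' t' U μ h))
  -- along `Ls`: `F (Ls j) = G (Ls j − 1)` eventually, and `G (Ls j − 1) → e_src`
  have hK : Tendsto (fun j => Ls j - 1) atTop atTop := (tendsto_sub_atTop_nat 1).comp hLs
  have hconv : Tendsto (fun j => G (Ls j - 1)) atTop (𝓝 (dWaveSourceEnergyDensityTT' t' U μ h)) :=
    (tendsto_dWaveSourceEnergyDensityTT' t' U μ h).comp hK
  refine tendsto_nhds_unique hlim (hconv.congr' ?_)
  filter_upwards [hK.eventually hev, hLs.eventually_ge_atTop 1] with j hj hj1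
  -- hj : F (Ls j - 1 + 1) = G (Ls j - 1)
  rw [← hj, Nat.sub_add_cancel hj1]

/-! ### §4 Certified finite-volume bounds pass to the limit -/

/-- **Certified lower bounds pass to the limit** (the output shape of
`dWaveSourceTorus_groundEnergy_ge_of_window_certificate_eventually`): if `lo · L² ≤ E₀(A_L)` for all
`L ≥ L₀`, then `lo ≤ e_src(U,μ,h)`. [cite: Ruelle1969, §3.3] -/
theorem dWaveSourceEnergyDensityTT'_ge_of_forall_le (t' U μ h : ℝ) {lo : ℝ} {L₀ : ℕ}
    (hlo : ∀ (L : ℕ) [NeZero L], L₀ ≤ L → lo * (L : ℝ) ^ 2 ≤ (dWaveSourceTorusTT' L t' U μ h).groundEnergy) :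
    lo ≤ dWaveSourceEnergyDensityTT' t' U μ h := by
  refine ge_of_tendsto (tendsto_dWaveSourceEnergyDensityTT' t' U μ h) ?_
  filter_upwards [eventually_ge_atTop L₀] with L hL
  have hpos : (0 : ℝ) < (((L + 1 : ℕ) : ℝ)) ^ 2 := by positivity
  rw [le_div_iff₀ hpos]
  exact hlo (L + 1) (by omega)

/-- **Certified upper bounds pass to the limit**: if `E₀(A_L) ≤ hi · L²` for all `L ≥ L₀` (e.g. Rayleigh
quotients of trial states on every large torus), then `e_src(U,μ,h) ≤ hi`. [cite: Ruelle1969, §3.3] -/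
theorem dWaveSourceEnergyDensityTT'_le_of_forall_le (t' U μ h : ℝ) {hi : ℝ} {L₀ : ℕ}
    (hhi : ∀ (L : ℕ) [NeZero L], L₀ ≤ L → (dWaveSourceTorusTT' L t' U μ h).groundEnergy ≤ hi * (L : ℝ) ^ 2) :
    dWaveSourceEnergyDensityTT' t' U μ h ≤ hi := by
  refine le_of_tendsto (tendsto_dWaveSourceEnergyDensityTT' t' U μ h) ?_
  filter_upwards [eventually_ge_atTop L₀] with L hL
  have hpos : (0 : ℝ) < (((L + 1 : ℕ) : ℝ)) ^ 2 := by positivity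
  rw [div_le_iff₀ hpos]
  exact hhi (L + 1) (by omega)

/-- `∀ᶠ`-form of the lower passage (sides `L + 1`). [cite: Ruelle1969, §3.3] -/
theorem dWaveSourceEnergyDensityTT'_ge_of_eventually_le (t' U μ h : ℝ) {lo : ℝ}
    (hlo : ∀ᶠ L : ℕ in atTop, lo * (((L + 1 : ℕ) : ℝ)) ^ 2 ≤ (dWaveSourceTorusTT' (L + 1) t' U μ h).groundEnergy) :
    lo ≤ dWaveSourceEnergyDensityTT' t' U μ h := by
  refine ge_of_tendsto (tendsto_dWaveSourceEnergyDensityTT' t' U μ h) ?_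
  filter_upwards [hlo] with L hL
  have hpos : (0 : ℝ) < (((L + 1 : ℕ) : ℝ)) ^ 2 := by positivity
  rwa [le_div_iff₀ hpos]

/-- `∀ᶠ`-form of the upper passage (sides `L + 1`). [cite: Ruelle1969, §3.3] -/
theorem dWaveSourceEnergyDensityTT'_le_of_eventually_le (t' U μ h : ℝ) {hi : ℝ}
    (hhi : ∀ᶠ L : ℕ in atTop, (dWaveSourceTorusTT' (L + 1) t' U μ h).groundEnergy ≤ hi * (((L + 1 : ℕ) : ℝ)) ^ 2) :
    dWaveSourceEnergyDensityTT' t' U μ h ≤ hi := by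
  refine le_of_tendsto (tendsto_dWaveSourceEnergyDensityTT' t' U μ h) ?_
  filter_upwards [hhi] with L hL
  have hpos : (0 : ℝ) < (((L + 1 : ℕ) : ℝ)) ^ 2 := by positivity
  rwa [div_le_iff₀ hpos]


/-! ### §1 Finite volume -/

/-- **Monotonicity on `h ≥ 0`, finite volume**: `0 ≤ h ≤ h' ⇒ E₀(A_L(h')) ≤ E₀(A_L(h))` (the sourced pair
density is `≥ 0` for `h ≥ 0`). [cite: KomaTasaki1994, §1] -/
theorem groundEnergy_dWaveSourceTorusTT'_anti (L : ℕ) [NeZero L] (t' U μ : ℝ) {h h' : ℝ} (hh : 0 ≤ h)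
    (hle : h ≤ h') :
    (dWaveSourceTorusTT' L t' U μ h').groundEnergy ≤ (dWaveSourceTorusTT' L t' U μ h).groundEnergy := by
  have h1 := dWaveSourceDensityTT'_mul_le_groundEnergy_drop (L := L) t' U μ h h'
  have h2 : 0 ≤ dWaveSourceDensityTT' L t' U μ h := dWaveSourceDensityTT'_nonneg t' U μ hh
  have hL : (0 : ℝ) ≤ 2 * (L : ℝ) ^ 2 * dWaveSourceDensityTT' L t' U μ h := by positivity
  nlinarith [h1, hL, sub_nonneg.2 hle]

/-! ### §2 Thermodynamic limit: the conditional dictionary made unconditional -/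

section Limit

variable (t' U μ : ℝ)

/-- **`h ↦ e_src(U,μ,h)` is concave on `ℝ`** (pointwise limit of the concave `E₀(A_{L+1})/(L+1)²`).
[cite: Griffiths1964, §II] -/
theorem concaveOn_dWaveSourceEnergyDensityTT' :
    ConcaveOn ℝ Set.univ fun h : ℝ => dWaveSourceEnergyDensityTT' t' U μ h := by
  refine ⟨convex_univ, fun x _ y _ p q hp hq hpq => ?_⟩
  simp only [smul_eq_mul]
  have hlim := ((tendsto_dWaveSourceEnergyDensityTT' t' U μ x).const_mul p).add
    ((tendsto_dWaveSourceEnergyDensityTT' t' U μ y).const_mul q)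
  refine le_of_tendsto_of_tendsto' hlim (tendsto_dWaveSourceEnergyDensityTT' t' U μ (p * x + q * y)) fun L => ?_
  have hc := (concaveOn_groundEnergy_dWaveSourceTorusTT' t' U μ (L + 1)).2 (Set.mem_univ x) (Set.mem_univ y)
    hp hq hpq
  simp only [smul_eq_mul] at hc
  have hpos : (0 : ℝ) < (((L + 1 : ℕ) : ℝ)) ^ 2 := by positivity
  rw [← mul_div_assoc, ← mul_div_assoc, ← add_div]
  exact div_le_div_of_nonneg_right hc hpos.le

/-- The `[0,∞)` form, through the conditional lemma of the cusp file. [cite: KomaTasaki1994, §1] -/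
theorem concaveOn_Ici_dWaveSourceEnergyDensityTT' :
    ConcaveOn ℝ (Set.Ici 0) (dWaveSourceEnergyDensityTT' t' U μ) :=
  concaveOn_Ici_of_tendsto_groundEnergy_dWaveSourceTT' t' U μ fun h _ => tendsto_dWaveSourceEnergyDensityTT' t' U μ h

/-- **Monotonicity on `h ≥ 0`**: `0 ≤ h ≤ h' ⇒ e_src(h') ≤ e_src(h)`. [cite: KomaTasaki1994, §1] -/
theorem dWaveSourceEnergyDensityTT'_anti {h h' : ℝ} (hh : 0 ≤ h) (hle : h ≤ h') :
    dWaveSourceEnergyDensityTT' t' U μ h' ≤ dWaveSourceEnergyDensityTT' t' U μ h := by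
  refine le_of_tendsto_of_tendsto' (tendsto_dWaveSourceEnergyDensityTT' t' U μ h')
    (tendsto_dWaveSourceEnergyDensityTT' t' U μ h) fun L => ?_
  have hpos : (0 : ℝ) < (((L + 1 : ℕ) : ℝ)) ^ 2 := by positivity
  exact div_le_div_of_nonneg_right (groundEnergy_dWaveSourceTorusTT'_anti (L + 1) t' U μ hh hle) hpos.le

/-- **The source never raises the energy density**: `e_src(U,μ,h) ≤ e_src(U,μ,0)` for every real `h`
(`groundEnergy_dWaveSourceTorus_le`). [cite: KomaTasaki1994, §1] -/
theorem dWaveSourceEnergyDensityTT'_le_at_zero (h : ℝ) :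
    dWaveSourceEnergyDensityTT' t' U μ h ≤ dWaveSourceEnergyDensityTT' t' U μ 0 := by
  refine le_of_tendsto_of_tendsto' (tendsto_dWaveSourceEnergyDensityTT' t' U μ h)
    (tendsto_dWaveSourceEnergyDensityTT' t' U μ 0) fun L => ?_
  have hpos : (0 : ℝ) < (((L + 1 : ℕ) : ℝ)) ^ 2 := by positivity
  exact div_le_div_of_nonneg_right (groundEnergy_dWaveSourceTorusTT'_le (L := L + 1) t' U μ h) hpos.le

/-- **Lipschitz continuity in the source**: `|e_src(h) − e_src(h')| ≤ 2 B_d |h − h'|`,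
`B_d = 2Σ_e |d(e)/√2|`. [cite: Israel1979, Thm. I.3.4] -/
theorem abs_dWaveSourceEnergyDensityTT'_sub_le (h h' : ℝ) :
    |dWaveSourceEnergyDensityTT' t' U μ h - dWaveSourceEnergyDensityTT' t' U μ h'| ≤
      2 * (2 * ∑ e ∈ insert (0 : Site 2) unitSteps, |dWaveFormFactor e / Real.sqrt 2|) * |h - h'| :=
  abs_sub_le_of_tendsto_groundEnergy_dWaveSourceTT' t' U μ (g := dWaveSourceEnergyDensityTT' t' U μ)
    (tendsto_dWaveSourceEnergyDensityTT' t' U μ h) (tendsto_dWaveSourceEnergyDensityTT' t' U μ h')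

/-- **Griffiths' lemma in the source, unconditional**: at a differentiability point `h` of
`e_src(U,μ,·)` with derivative `e'`, the sourced pair densities converge, `m_{L+1}(h) → −e'/2`.
[cite: Griffiths1966, §II] -/
theorem tendsto_dWaveSourceDensityTT'_of_hasDerivAt_energyDensity {h e' : ℝ}
    (hd : HasDerivAt (dWaveSourceEnergyDensityTT' t' U μ) e' h) :
    Tendsto (fun L : ℕ => dWaveSourceDensityTT' (L + 1) t' U μ h) atTop (𝓝 (-e' / 2)) :=
  tendsto_dWaveSourceDensityTT'_of_hasDerivAt t' U μ
    (Eventually.of_forall fun h' => tendsto_dWaveSourceEnergyDensityTT' t' U μ h') hd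

/-- **Left half**: a left derivative `e'₋` of `e_src` at `h` gives `−e'₋/2 ≤ liminf_L m_{L+1}(h)`.
[cite: Griffiths1966, §II] -/
theorem neg_half_leftDeriv_le_liminf_dWaveSourceDensityTT' {h e' : ℝ}
    (hd : HasDerivWithinAt (dWaveSourceEnergyDensityTT' t' U μ) e' (Set.Iio h) h) :
    -e' / 2 ≤ liminf (fun L : ℕ => dWaveSourceDensityTT' (L + 1) t' U μ h) atTop :=
  neg_half_deriv_le_liminf_dWaveSourceDensityTT' t' U μ
    (Eventually.of_forall fun h₁ => tendsto_dWaveSourceEnergyDensityTT' t' U μ h₁)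
    (tendsto_dWaveSourceEnergyDensityTT' t' U μ h) hd

/-- **Right half**: a right derivative `e'₊` of `e_src` at `h` gives `limsup_L m_{L+1}(h) ≤ −e'₊/2`.
[cite: Griffiths1966, §II] -/
theorem limsup_dWaveSourceDensityTT'_le_neg_half_rightDeriv {h e' : ℝ}
    (hd : HasDerivWithinAt (dWaveSourceEnergyDensityTT' t' U μ) e' (Set.Ioi h) h) :
    limsup (fun L : ℕ => dWaveSourceDensityTT' (L + 1) t' U μ h) atTop ≤ -e' / 2 :=
  limsup_dWaveSourceDensityTT'_le_neg_half_deriv t' U μ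
    (Eventually.of_forall fun h₂ => tendsto_dWaveSourceEnergyDensityTT' t' U μ h₂)
    (tendsto_dWaveSourceEnergyDensityTT' t' U μ h) hd

/-- **THE CUSP IDENTITY, infimum form (unconditional)**:
`dWaveOrderParameterTT' t' U μ = ⨅_{h>0} (e_src(0) − e_src(h))/(2h)`. [cite: KomaTasaki1994, §1] -/
theorem dWaveOrderParameterTT'_eq_iInf_slope_energyDensity :
    dWaveOrderParameterTT' t' U μ =
      ⨅ h : Set.Ioi (0 : ℝ), (dWaveSourceEnergyDensityTT' t' U μ 0 - dWaveSourceEnergyDensityTT' t' U μ h) / (2 * h) :=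
  dWaveOrderParameterTT'_eq_iInf_slope t' U μ fun h _ => tendsto_dWaveSourceEnergyDensityTT' t' U μ h

/-- **THE CUSP IDENTITY, limit form (unconditional)**:
`(e_src(0) − e_src(h))/(2h) → dWaveOrderParameterTT' t' U μ` as `h → 0⁺`. [cite: KomaTasaki1994, §1] -/
theorem tendsto_slope_energyDensity_dWaveOrderParameterTT' :
    Tendsto (fun h : ℝ => (dWaveSourceEnergyDensityTT' t' U μ 0 - dWaveSourceEnergyDensityTT' t' U μ h) / (2 * h))
      (𝓝[>] 0) (𝓝 (dWaveOrderParameterTT' t' U μ)) :=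
  tendsto_slope_nhdsGT_dWaveOrderParameterTT' t' U μ fun h _ => tendsto_dWaveSourceEnergyDensityTT' t' U μ h

/-- **THE CUSP IDENTITY, derivative form (unconditional)**: if `e_src(U,μ,·)` has a right derivative
`e'₊(0)` at `h = 0`, then `dWaveOrderParameterTT' t' U μ = −e'₊(0)/2`. [cite: Griffiths1966, §II] -/
theorem dWaveOrderParameterTT'_eq_neg_half_rightDeriv_energyDensity {e' : ℝ}
    (hd : HasDerivWithinAt (dWaveSourceEnergyDensityTT' t' U μ) e' (Set.Ioi 0) 0) :
    dWaveOrderParameterTT' t' U μ = -e' / 2 :=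
  dWaveOrderParameterTT'_eq_neg_half_deriv t' U μ (fun h _ => tendsto_dWaveSourceEnergyDensityTT' t' U μ h) hd

/-- **`d`-wave order IS a linear cusp of `e_src` at `h = 0` (unconditional)**:
`HasDWaveOrderTT' t' U μ ↔ ∃ c > 0, ∀ h > 0, e_src(h) ≤ e_src(0) − 2ch`. [cite: KomaTasaki1994, §1] -/
theorem hasDWaveOrderTT'_iff_linear_cusp_energyDensity :
    HasDWaveOrderTT' t' U μ ↔ ∃ c : ℝ, 0 < c ∧ ∀ h : ℝ, 0 < h →
      dWaveSourceEnergyDensityTT' t' U μ h ≤ dWaveSourceEnergyDensityTT' t' U μ 0 - 2 * c * h :=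
  hasDWaveOrderTT'_iff_linear_cusp t' U μ fun h _ => tendsto_dWaveSourceEnergyDensityTT' t' U μ h

/-- **No kink, no order (unconditional)**: a vanishing right derivative of `e_src` at `0` excludes
`d`-wave order. [cite: KomaTasaki1994, §1] -/
theorem not_hasDWaveOrderTT'_of_rightDeriv_energyDensity_zero
    (hd : HasDerivWithinAt (dWaveSourceEnergyDensityTT' t' U μ) 0 (Set.Ioi 0) 0) : ¬ HasDWaveOrderTT' t' U μ :=
  not_hasDWaveOrderTT'_of_hasDerivWithinAt_zero t' U μ (fun h _ => tendsto_dWaveSourceEnergyDensityTT' t' U μ h) hd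

/-- **The sign of the kink decides (unconditional)**: with a right derivative `e'₊(0)` of `e_src` at `0`,
`HasDWaveOrderTT' t' U μ ↔ e'₊(0) < 0`. [cite: KomaTasaki1994, §1] -/
theorem hasDWaveOrderTT'_iff_rightDeriv_energyDensity_neg {e' : ℝ}
    (hd : HasDerivWithinAt (dWaveSourceEnergyDensityTT' t' U μ) e' (Set.Ioi 0) 0) :
    HasDWaveOrderTT' t' U μ ↔ e' < 0 :=
  hasDWaveOrderTT'_iff_deriv_neg t' U μ (fun h _ => tendsto_dWaveSourceEnergyDensityTT' t' U μ h) hd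

/-- **One chord bounds the order parameter from above**: for every `h > 0`,
`dWaveOrderParameterTT' t' U μ ≤ (e_src(0) − e_src(h))/(2h)`. [cite: KomaTasaki1994, §1] -/
theorem dWaveOrderParameterTT'_le_slope_energyDensity {h : ℝ} (hh : 0 < h) :
    dWaveOrderParameterTT' t' U μ ≤
      (dWaveSourceEnergyDensityTT' t' U μ 0 - dWaveSourceEnergyDensityTT' t' U μ h) / (2 * h) := by
  set e : ℝ → ℝ := dWaveSourceEnergyDensityTT' t' U μ with he
  have hbdd : BddBelow (Set.range fun h' : Set.Ioi (0 : ℝ) => (e 0 - e h') / (2 * (h' : ℝ))) := by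
    refine ⟨0, ?_⟩
    rintro x ⟨h', rfl⟩
    have h0 : (0 : ℝ) < (h' : ℝ) := h'.2
    have h1 : e h' ≤ e 0 := dWaveSourceEnergyDensityTT'_le_at_zero t' U μ h'
    exact div_nonneg (sub_nonneg.2 h1) (by positivity)
  have key := ciInf_le hbdd ⟨h, hh⟩
  rw [dWaveOrderParameterTT'_eq_iInf_slope_energyDensity]
  exact key

/-- **The "m⋆ ceiling" row in thermodynamic-limit form**: a certified LOWER bound `lo ≤ e_src(h)` at ONE
source strength `h > 0` and a certified UPPER bound `e_src(0) ≤ hi` on the source-free energy density give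
`dWaveOrderParameterTT' t' U μ ≤ (hi − lo)/(2h)`. (A ceiling, never a floor: `le_dWaveOrderParameter_iff_forall`.)
[cite: KomaTasaki1994, §1] -/
theorem dWaveOrderParameterTT'_le_of_windows {h lo hi : ℝ} (hh : 0 < h)
    (hlo : lo ≤ dWaveSourceEnergyDensityTT' t' U μ h) (hhi : dWaveSourceEnergyDensityTT' t' U μ 0 ≤ hi) :
    dWaveOrderParameterTT' t' U μ ≤ (hi - lo) / (2 * h) := by
  refine (dWaveOrderParameterTT'_le_slope_energyDensity t' U μ hh).trans ?_
  exact div_le_div_of_nonneg_right (by linarith) (by positivity)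

end Limit

/-! ### §3 Transport of certified windows -/

section Transport

variable (t' U μ : ℝ)

/-- **Barycentric LOWER bound** (Jensen): certified `lo₁ ≤ e_src(h₁)`, `lo₂ ≤ e_src(h₂)` and convex
weights `p, q ≥ 0`, `p + q = 1` give `p·lo₁ + q·lo₂ ≤ e_src(p h₁ + q h₂)` — every point between two
certified lower bounds is certified from below. [cite: Griffiths1964, §II] -/
theorem dWaveSourceEnergyDensityTT'_convexComb_ge {h₁ h₂ lo₁ lo₂ p q : ℝ} (hp : 0 ≤ p) (hq : 0 ≤ q)
    (hpq : p + q = 1) (h1 : lo₁ ≤ dWaveSourceEnergyDensityTT' t' U μ h₁) (h2 : lo₂ ≤ dWaveSourceEnergyDensityTT' t' U μ h₂) :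
    p * lo₁ + q * lo₂ ≤ dWaveSourceEnergyDensityTT' t' U μ (p * h₁ + q * h₂) := by
  have hc := (concaveOn_dWaveSourceEnergyDensityTT' t' U μ).2 (Set.mem_univ h₁) (Set.mem_univ h₂) hp hq hpq
  simp only [smul_eq_mul] at hc
  nlinarith [hc, mul_le_mul_of_nonneg_left h1 hp, mul_le_mul_of_nonneg_left h2 hq]

/-- **Chord LOWER bound between two anchors** (the barycentric bound in coordinates): for `h₁ < h₂` and
`h ∈ [h₁, h₂]`, `lo₁ + (lo₂ − lo₁)(h − h₁)/(h₂ − h₁) ≤ e_src(h)`. [cite: Griffiths1964, §II] -/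
theorem dWaveSourceEnergyDensityTT'_ge_chord {h₁ h₂ h lo₁ lo₂ : ℝ} (hlt : h₁ < h₂) (ha : h₁ ≤ h) (hb : h ≤ h₂)
    (h1 : lo₁ ≤ dWaveSourceEnergyDensityTT' t' U μ h₁) (h2 : lo₂ ≤ dWaveSourceEnergyDensityTT' t' U μ h₂) :
    lo₁ + (lo₂ - lo₁) * (h - h₁) / (h₂ - h₁) ≤ dWaveSourceEnergyDensityTT' t' U μ h := by
  have hd : 0 < h₂ - h₁ := sub_pos.2 hlt
  set q : ℝ := (h - h₁) / (h₂ - h₁) with hqdef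
  set p : ℝ := 1 - q with hpdef
  have hq0 : 0 ≤ q := div_nonneg (sub_nonneg.2 ha) hd.le
  have hq1 : q ≤ 1 := by rw [hqdef, div_le_one hd]; linarith
  have hp0 : 0 ≤ p := by rw [hpdef]; linarith
  have hpq : p + q = 1 := by rw [hpdef]; ring
  have key := dWaveSourceEnergyDensityTT'_convexComb_ge t' U μ hp0 hq0 hpq h1 h2
  have hh : p * h₁ + q * h₂ = h := by
    rw [hpdef, hqdef]; field_simp; ring
  rw [hh] at key
  have hval : p * lo₁ + q * lo₂ = lo₁ + (lo₂ - lo₁) * (h - h₁) / (h₂ - h₁) := by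
    rw [hpdef, hqdef]; field_simp; ring
  linarith [key, hval]

/-- **Outward UPPER bound along the source axis**: for `h₁ < h₂`, a certified lower bound `lo₁ ≤ e_src(h₁)`
and a certified upper bound `e_src(h₂) ≤ hi₂` give, at `h₃ = h₂ + θ(h₂ − h₁)` (`θ ≥ 0`, beyond `h₂`),
`e_src(h₃) ≤ hi₂ + θ(hi₂ − lo₁)` (concavity: `h₂` is a convex combination of `h₁` and `h₃`).
[cite: Griffiths1964, §II] -/
theorem dWaveSourceEnergyDensityTT'_le_extrapolate {h₁ h₂ θ lo₁ hi₂ : ℝ} (hθ : 0 ≤ θ)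
    (h1 : lo₁ ≤ dWaveSourceEnergyDensityTT' t' U μ h₁) (h2 : dWaveSourceEnergyDensityTT' t' U μ h₂ ≤ hi₂) :
    dWaveSourceEnergyDensityTT' t' U μ (h₂ + θ * (h₂ - h₁)) ≤ hi₂ + θ * (hi₂ - lo₁) := by
  -- `h₂ = (θ/(1+θ)) h₁ + (1/(1+θ)) h₃`
  have h1θ : 0 < 1 + θ := by linarith
  set p : ℝ := θ / (1 + θ) with hpdef
  set q : ℝ := 1 / (1 + θ) with hqdef
  have hp0 : 0 ≤ p := div_nonneg hθ h1θ.le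
  have hq0 : 0 ≤ q := div_nonneg zero_le_one h1θ.le
  have hpq : p + q = 1 := by rw [hpdef, hqdef, ← add_div, add_comm, div_self h1θ.ne']
  have hc := (concaveOn_dWaveSourceEnergyDensityTT' t' U μ).2 (Set.mem_univ h₁) (Set.mem_univ (h₂ + θ * (h₂ - h₁)))
    hp0 hq0 hpq
  simp only [smul_eq_mul] at hc
  have hh : p * h₁ + q * (h₂ + θ * (h₂ - h₁)) = h₂ := by
    rw [hpdef, hqdef]; field_simp; ring
  rw [hh] at hc
  -- `hc : p e(h₁) + q e(h₃) ≤ e(h₂)`; multiply by `1 + θ`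
  have hc' : θ * dWaveSourceEnergyDensityTT' t' U μ h₁ + dWaveSourceEnergyDensityTT' t' U μ (h₂ + θ * (h₂ - h₁)) ≤
      (1 + θ) * dWaveSourceEnergyDensityTT' t' U μ h₂ := by
    have := mul_le_mul_of_nonneg_left hc h1θ.le
    have e1 : (1 + θ) * (p * dWaveSourceEnergyDensityTT' t' U μ h₁ +
        q * dWaveSourceEnergyDensityTT' t' U μ (h₂ + θ * (h₂ - h₁))) =
        θ * dWaveSourceEnergyDensityTT' t' U μ h₁ + dWaveSourceEnergyDensityTT' t' U μ (h₂ + θ * (h₂ - h₁)) := by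
      rw [hpdef, hqdef]; field_simp
    linarith [this, e1]
  nlinarith [hc', mul_le_mul_of_nonneg_left h1 hθ, mul_le_mul_of_nonneg_left h2 h1θ.le]

/-- **Monotone transport of a LOWER bound** (`h ≥ 0`): a certified `lo ≤ e_src(h₂)` holds at every
`h ∈ [0, h₂]`. [cite: KomaTasaki1994, §1] -/
theorem dWaveSourceEnergyDensityTT'_ge_of_ge_at_larger {h h₂ lo : ℝ} (hh : 0 ≤ h) (hle : h ≤ h₂)
    (h2 : lo ≤ dWaveSourceEnergyDensityTT' t' U μ h₂) : lo ≤ dWaveSourceEnergyDensityTT' t' U μ h :=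
  h2.trans (dWaveSourceEnergyDensityTT'_anti t' U μ hh hle)

/-- **Monotone transport of an UPPER bound** (`h ≥ 0`): a certified `e_src(h₁) ≤ hi` holds at every
`h ≥ h₁ ≥ 0`; in particular every certified upper bound on the source-FREE energy density bounds every
sourced one (`dWaveSourceEnergyDensity_le_at_zero`). [cite: KomaTasaki1994, §1] -/
theorem dWaveSourceEnergyDensityTT'_le_of_le_at_smaller {h₁ h hi : ℝ} (hh : 0 ≤ h₁) (hle : h₁ ≤ h)
    (h1 : dWaveSourceEnergyDensityTT' t' U μ h₁ ≤ hi) : dWaveSourceEnergyDensityTT' t' U μ h ≤ hi :=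
  (dWaveSourceEnergyDensityTT'_anti t' U μ hh hle).trans h1

/-- An upper bound at `h = 0` bounds every sourced energy density. [cite: KomaTasaki1994, §1] -/
theorem dWaveSourceEnergyDensityTT'_le_of_le_at_zero {h hi : ℝ} (h0 : dWaveSourceEnergyDensityTT' t' U μ 0 ≤ hi) :
    dWaveSourceEnergyDensityTT' t' U μ h ≤ hi :=
  (dWaveSourceEnergyDensityTT'_le_at_zero t' U μ h).trans h0

/-- **Lipschitz transport of a LOWER bound**: `lo ≤ e_src(h)` gives `lo − 2B_d|h' − h| ≤ e_src(h')`.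
[cite: Israel1979, Thm. I.3.4] -/
theorem dWaveSourceEnergyDensityTT'_ge_lipschitz {h h' lo : ℝ} (h1 : lo ≤ dWaveSourceEnergyDensityTT' t' U μ h) :
    lo - 2 * (2 * ∑ e ∈ insert (0 : Site 2) unitSteps, |dWaveFormFactor e / Real.sqrt 2|) * |h' - h| ≤
      dWaveSourceEnergyDensityTT' t' U μ h' := by
  have h2 := abs_dWaveSourceEnergyDensityTT'_sub_le t' U μ h h'
  rw [abs_sub_comm h h'] at h2
  have h3 := (abs_le.1 h2).2
  linarith

/-- **Lipschitz transport of an UPPER bound**: `e_src(h) ≤ hi` gives `e_src(h') ≤ hi + 2B_d|h' − h|`.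
[cite: Israel1979, Thm. I.3.4] -/
theorem dWaveSourceEnergyDensityTT'_le_lipschitz {h h' hi : ℝ} (h1 : dWaveSourceEnergyDensityTT' t' U μ h ≤ hi) :
    dWaveSourceEnergyDensityTT' t' U μ h' ≤
      hi + 2 * (2 * ∑ e ∈ insert (0 : Site 2) unitSteps, |dWaveFormFactor e / Real.sqrt 2|) * |h' - h| := by
  have h2 := abs_dWaveSourceEnergyDensityTT'_sub_le t' U μ h h'
  rw [abs_sub_comm h h'] at h2
  have h3 := (abs_le.1 h2).1
  linarith

end Transport

end Literature.MathematicalPhysics.QuantumLattice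

end
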